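import Summits.QuantumFields.BalabanUV.Beta.GAN24.BlockRatesFromSoftResolvent

/-!
# `BalabanUV.Beta.GAN24.BlockRatesFromSoftColumn` — binder row G-an2-4 ∕ (CONV-C), route R6 «VALUES, NOT DERIVATIVES», PART 117 (CURRENCY REPAIR of PART 113 §3–§4):
# «ONE SOFT COLUMN LETTER» — Σ's and Ξ's RATE from the ONE-LEG-AVERAGED one-step law of the soft resolvent `C := (Qf·K′⁻¹·Qfᵀ − K⁻¹)·Qᵀ` (the soft
# COLUMNS' averaged mismatch, fine × unit), NOT from the entrywise `E = Qf·K′⁻¹·Qfᵀ − K⁻¹` (fine × fine) of PART 113 §3: the column letter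
# `|C(x,b′)| ≤ ε·e^{−δσ(x,b′)}` CAN carry a geometric `ε_k` with a k-uniform `δ` along the tower (at `U = 1` it is typed: leaf-02's
# `GAN24/SoftMinimiserTowerCubic` §4), the entrywise one CANNOT in any dimension `d ≥ 2` (the diagonal of the soft resolvent grows like `η^{2−d}`, `ln` in `d = 2`;
# `E(x,x) = O(K⁻¹(x,x))` — ROUTES-GAN24 (P-R7a), this lineage's V40, leaf-02 g77's engines E-leaf02-g77-1∕-2) (unit b2b-balaban-gan24-p3, gen 51; v2 = v1 + §4; §1–§2 ADOPTED
# from gan24-formalise-leaf-02 g77's typed suggestion `BlockRatesFromSoftColumn.suggest.e6b094555a7098c1.NOT-TO-FILE.lean`, INBOX [LEAF02-G77-INBOX-4])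

NOT IN PRINT; OUR PROOF ([folklore] — one row-mass transfer for a COLUMN kernel and PARTs 107 `abs_effForm_sub_effForm_le` ∕ 112 `abs_avg_minOp_sub_le` ∕ 113 §1 BY NAME).
HONEST FRAMING (cell contract, verbatim): «discharging `BetaPertH` makes Bałaban's UV stability UNCONDITIONAL — a real constructive-QFT result; it is NOT the continuum limit and NOT
the Clay problem.»  HONEST DEPENDENCY (verbatim): «continuum YM on T⁴ ⇐ BetaPertH ∧ nine spine estimates (0/9 proved); BetaPertH ⇐ (D1) ∧ (D4) ∧ CAP+tail; G-an2-4 gates asym, D1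
and NE2/3/4.»

WHY THIS FILE.  PART 113 reduced the two RATE letters of the 2 × 2 table (PART 107's `|P − P′| ≤ ε₂e^{−δ₀ρ}` and PART 112's `|Qf·K′⁻¹Q′ᵀ − K⁻¹Qᵀ| ≤ ε₁e^{−δ₁σ}`) to ONE letter,
but stated that letter ENTRYWISE on the fine lattice (`|E(x,y)| ≤ εe^{−δD(x,y)}`, §3 `abs_blockProp_sub_le_of_soft` ∕ `abs_avg_col_sub_le_of_soft`, §4 `…_of_soft`).  In the tower's
currency (`a` and the unit averaging `Q` = block MEAN fixed, fine form `∼ η^{d−2}·(−Δ_graph)`), the fine × fine entries of the soft resolvent do NOT converge — its diagonal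
grows like `η^{2−d}` (`d ≥ 3`) ∕ by `ln L∕(2π)` per level (`d = 2`, ROUTES-GAN24 (P-R7a): `+0.110∕level` at `L = 2`) — so `ε_k → 0` is impossible for the entrywise letter: the
§3–§4 ENDs of PART 113 are correct but VACUOUS along the tower.  The same two rate letters follow from the COLUMN letter `|((Qf·K′⁻¹·Qfᵀ − K⁻¹)·Qᵀ)(x,b′)| ≤ εe^{−δσ(x,b′)}`
(ONE unit leg averaged; `= a⁻¹·(Qf·M′ − M)` for the soft minimisers `M = aK⁻¹Qᵀ`, `M′ = aK′⁻¹Q′ᵀ`, `Q′ = Q·Qf`) — which IS instantiable with `ε_k ∝ θ^k`, k-uniform `δ`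
(at `U = 1`, scalar: leaf-02's `GAN24/SoftMinimiserTowerCubic` §4 `norm_Qavg0_Msoft_succ_sub_le_lev`; road P2's `SoftMinimiserOneStepSup` in the prolongation direction) — by ONE
row-mass transfer, with the improved constant `q₁εe^{δR″}` (LINEAR in `q₁`, not `q₁²`).  This file is PART 113 §3–§4 RE-BASED on the column letter; PART 113 §1–§2 and PARTs
107 ∕ 112 ∕ 114's LETTER forms are unaffected (their letters are unit × unit ∕ one-leg-averaged, hence sound).  The remaining fine × fine letter of the lineage — PART 105 §4's
sup-entry decay `|K⁻¹(x,x′)| ≤ Ce^{−δD}` feeding `abs_blockProp_le_of_resolvent` — has the same defect for `d ≥ 3` (not k-uniform); its sound replacement is the ℓ²-PAIRING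
Combes–Thomas bound (D4's `MultiscaleCombesThomas.combesThomas_local`) or directly the column ∕ block letters of PART 105 §2–§3, which are the ones the ENDs consume.

WHAT THIS FILE PROVES (0 sorry, 0 `def`, nothing cited; letters as in PART 113: unit index `c` (`ρ`, `Kf`), fine index sets `ν` (coarser), `ν′` (finer), fine-to-unit gauge
`σ : ν → c → ℝ`, `Q : Matrix c ν ℝ`, `Qf : Matrix ν ν′ ℝ`, `K`, `K′` ANY square matrices in §1–§2):
* §1 **`abs_Q_mul_apply_le`** (leaf-02 g77): row-mass transfer for a COLUMN kernel — `|C(x,b′)| ≤ εe^{−δσ(x,b′)}`, `Σ_x|Q(b,x)| ≤ q₁`, `Q(b,x) ≠ 0 → ρ(b,b′) ≤ σ(x,b′) + R″` ⟹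
  `|(Q·C)(b,b′)| ≤ q₁εe^{δR″}e^{−δρ(b,b′)}`.
* §2 **`abs_blockProp_sub_le_of_col`** (`P_K(Q) − P_{K′}(Q·Qf) = −Q·C` ⟹ PART 107's `hdiff` with `ε₂ = q₁εe^{δR″}`), **`abs_avg_col_sub_le_of_col`** (PART 112's `hmis` IS the column
  letter, `ε₁ = ε`) (both leaf-02 g77).
* §3 **`abs_effForm_sub_le_of_col`** (Σ's RATE from the column letter: PART 107's bound with `ε₂ = q₁εe^{δR″}`) and **`abs_avg_minOp_sub_le_of_col`** (Ξ's RATE: PART 112's bound with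
  `ε₁ = ε`, `ε₂ = q₁εe^{δR″}`) — PART 113 §4 with `hE` replaced by `hcol`; both LINEAR in `ε`.
* §4 (v2) **`abs_blockProp_le_of_col`**: P's DECAY letter of PART 105 §2 from the COLUMN decay letter of PART 105 §3 (`(c₀, δ₀) = (q₁c₁e^{δ₁R″}, δ₁)`) — PART 105 §4's sup-entry route
  superseded; the 2 × 2 table runs on TWO COLUMN letters + UB.
WHAT IT DOES NOT DO: supply the column letter with background (Bałaban-class; in OPERATOR currency the with-background one-step law is NE2's resolvent route — PARTs 115 ∕ 116); the
𝒢-block (PART 114's `E` enters naked: a fine × fine statement, to be read unit-averaged); instantiate.  SUPPLIER work on route C-R6° (rank 2, REDUCTION); no consumer of record; NEVER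
«G-an2-4 closed»; NOT (CONV-C), NOT D1, NOT `BetaPertH`, NOT continuum, NOT Clay.  Records: `HOME/b2b-balaban-gan24-p3/gen51/README.md`.
-/

noncomputable section

open scoped BigOperators Matrix
open Finset Matrix
open Literature.MathematicalPhysics.QuantumFieldTheory.Balaban1983to89
open Literature.MathematicalPhysics.QuantumFieldTheory.Balaban1983to89.B4Sect5Torus (IsPseudoDist SumBound rate rate_pos rate_le_delta0)
open Literature.MathematicalPhysics.QuantumFieldTheory.Balaban1983to89.Beta.Composition (blockProp)
open Literature.MathematicalPhysics.QuantumFieldTheory.Balaban1983to89.Beta.CompositionSingular (effForm minOp)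
open Summit.QuantumFields.BalabanUV.Beta.GAN24.EffectiveFormRateTransfer (abs_effForm_sub_effForm_le)
open Summit.QuantumFields.BalabanUV.Beta.GAN24.HardMinimiserRateTransfer (abs_avg_minOp_sub_le)
open Summit.QuantumFields.BalabanUV.Beta.GAN24.BlockRatesFromSoftResolvent (blockProp_sub_blockProp_mul avg_mul_col_sub_eq)

namespace Summit.QuantumFields.BalabanUV.Beta.GAN24.BlockRatesFromSoftColumn

variable {c ν ν' : Type*} [Fintype c] [Fintype ν] [Fintype ν'] [DecidableEq c] [DecidableEq ν] [DecidableEq ν']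

/-! ## §1 Row-mass transfer for a column kernel -/

section Transfer

variable {Q : Matrix c ν ℝ} {ρ : c → c → ℝ} {σ : ν → c → ℝ}

omit [Fintype c] [DecidableEq c] [DecidableEq ν] in
/-- **`abs_Q_mul_apply_le` — ROW-MASS TRANSFER FOR A COLUMN KERNEL** [folklore; leaf-02 g77's typed suggestion, adopted verbatim]: `|C(x,b′)| ≤ εe^{−δσ(x,b′)}` (`ε, δ ≥ 0`),
`Σ_x|Q(b,x)| ≤ q₁`, `Q(b,x) ≠ 0 → ρ(b,b′) ≤ σ(x,b′) + R″` ⟹ `|(Q·C)(b,b′)| ≤ q₁·ε·e^{δR″}·e^{−δρ(b,b′)}`. -/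
theorem abs_Q_mul_apply_le {C : Matrix ν c ℝ} {ε δ q₁ R'' : ℝ} (hε : 0 ≤ ε) (hδ : 0 ≤ δ)
    (hC : ∀ x b', |C x b'| ≤ ε * Real.exp (-(δ * σ x b'))) (hq : ∀ b, ∑ x, |Q b x| ≤ q₁)
    (hQρσ : ∀ b x b', Q b x ≠ 0 → ρ b b' ≤ σ x b' + R'') (b b' : c) :
    |(Q * C) b b'| ≤ q₁ * ε * Real.exp (δ * R'') * Real.exp (-(δ * ρ b b')) := by
  have hpt : ∀ x, |Q b x * C x b'| ≤ |Q b x| * (ε * Real.exp (δ * R'') * Real.exp (-(δ * ρ b b'))) := by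
    intro x
    rw [abs_mul]
    by_cases hx : Q b x = 0
    · simp [hx]
    have hcomp := hQρσ b x b' hx
    have hexp : Real.exp (-(δ * σ x b')) ≤ Real.exp (δ * R'') * Real.exp (-(δ * ρ b b')) := by
      rw [← Real.exp_add]; apply Real.exp_le_exp.mpr; nlinarith
    calc |Q b x| * |C x b'| ≤ |Q b x| * (ε * Real.exp (-(δ * σ x b'))) := mul_le_mul_of_nonneg_left (hC x b') (abs_nonneg _)
      _ ≤ |Q b x| * (ε * (Real.exp (δ * R'') * Real.exp (-(δ * ρ b b')))) :=
          mul_le_mul_of_nonneg_left (mul_le_mul_of_nonneg_left hexp hε) (abs_nonneg _)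
      _ = |Q b x| * (ε * Real.exp (δ * R'') * Real.exp (-(δ * ρ b b'))) := by ring
  rw [Matrix.mul_apply]
  calc |∑ x, Q b x * C x b'| ≤ ∑ x, |Q b x * C x b'| := Finset.abs_sum_le_sum_abs _ _
    _ ≤ ∑ x, |Q b x| * (ε * Real.exp (δ * R'') * Real.exp (-(δ * ρ b b'))) := Finset.sum_le_sum fun x _ => hpt x
    _ = (∑ x, |Q b x|) * (ε * Real.exp (δ * R'') * Real.exp (-(δ * ρ b b'))) := by rw [Finset.sum_mul]
    _ ≤ q₁ * (ε * Real.exp (δ * R'') * Real.exp (-(δ * ρ b b'))) := mul_le_mul_of_nonneg_right (hq b) (by positivity)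
    _ = q₁ * ε * Real.exp (δ * R'') * Real.exp (-(δ * ρ b b')) := by ring

/-! ## §2 The two rate letters of PARTs 107 ∕ 112 from the one COLUMN letter -/

omit [Fintype c] [DecidableEq c] in
/-- **`abs_blockProp_sub_le_of_col` — THE BLOCK PROPAGATOR's ONE-STEP INCREMENT FROM THE COLUMN LETTER** [folklore; leaf-02 g77]: for ANY square `K` on `ν`, `K′` on `ν′`,
`P_K(Q) − P_{K′}(Q·Qf) = −Q·((Qf·K′⁻¹·Qfᵀ − K⁻¹)·Qᵀ)` (PART 113 §1), hence `|(P − P′)(b,b′)| ≤ q₁·ε·e^{δR″}·e^{−δρ(b,b′)}` — PART 107's `hdiff` letter with `ε₂ = q₁εe^{δR″}`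
(LINEAR in `q₁`). -/
theorem abs_blockProp_sub_le_of_col {K : Matrix ν ν ℝ} {K' : Matrix ν' ν' ℝ} {Qf : Matrix ν ν' ℝ} {ε δ q₁ R'' : ℝ} (hε : 0 ≤ ε) (hδ : 0 ≤ δ)
    (hcol : ∀ x b', |((Qf * K'⁻¹ * Qfᵀ - K⁻¹) * Qᵀ) x b'| ≤ ε * Real.exp (-(δ * σ x b'))) (hq : ∀ b, ∑ x, |Q b x| ≤ q₁)
    (hQρσ : ∀ b x b', Q b x ≠ 0 → ρ b b' ≤ σ x b' + R'') (b b' : c) :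
    |(blockProp K Q - blockProp K' (Q * Qf)) b b'| ≤ q₁ * ε * Real.exp (δ * R'') * Real.exp (-(δ * ρ b b')) := by
  have e : blockProp K Q - blockProp K' (Q * Qf) = -(Q * ((Qf * K'⁻¹ * Qfᵀ - K⁻¹) * Qᵀ)) := by
    rw [blockProp_sub_blockProp_mul]
    simp only [Matrix.mul_sub, Matrix.sub_mul, Matrix.mul_assoc, neg_sub]
  rw [e, Matrix.neg_apply, abs_neg]
  exact abs_Q_mul_apply_le hε hδ hcol hq hQρσ b b'

omit [Fintype c] [DecidableEq c] in
/-- **`abs_avg_col_sub_le_of_col` — Ξ's LETTER IS THE COLUMN LETTER VERBATIM** [folklore; leaf-02 g77; PART 113's `avg_mul_col_sub_eq`]: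
`|(Qf·(K′⁻¹·(Q·Qf)ᵀ) − K⁻¹·Qᵀ)(x,b)| ≤ ε·e^{−δσ(x,b)}` — PART 112's `hmis` with `ε₁ = ε`. -/
theorem abs_avg_col_sub_le_of_col {K : Matrix ν ν ℝ} {K' : Matrix ν' ν' ℝ} {Qf : Matrix ν ν' ℝ} {ε δ : ℝ}
    (hcol : ∀ x b', |((Qf * K'⁻¹ * Qfᵀ - K⁻¹) * Qᵀ) x b'| ≤ ε * Real.exp (-(δ * σ x b'))) (x : ν) (b : c) :
    |(Qf * (K'⁻¹ * (Q * Qf)ᵀ) - K⁻¹ * Qᵀ) x b| ≤ ε * Real.exp (-(δ * σ x b)) := by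
  rw [avg_mul_col_sub_eq]
  exact hcol x b

end Transfer

/-! ## §3 Σ's and Ξ's RATE from the one column letter (PART 113 §4 re-based) -/

section End

variable {H : Matrix ν ν ℝ} {Q : Matrix c ν ℝ} {H' : Matrix ν' ν' ℝ} {Qf : Matrix ν ν' ℝ} {a : ℝ}
variable {ρ : c → c → ℝ} {Kf : ℝ → ℝ} {σ : ν → c → ℝ}

/-- **`abs_effForm_sub_le_of_col` — Σ's RATE FROM THE SOFT COLUMNS' ONE-STEP LAW** [our proof; §2 + PART 107 `abs_effForm_sub_effForm_le` BY NAME]: two constrained data `(H, Q)` on `ν` and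
`(H′, Q·Qf)` on `ν′` under PART 105's hypotheses at both levels (symmetric PSD forms, `a > 0`, `K = H + Qᵀ(a•1)Q` and `K′ = H′ + (QQf)ᵀ(a•1)(QQf)` coercive, upper bound `Λ`, unit decay
of both block propagators at `(c₀, δ₀)`), the ONE COLUMN letter `|((Qf·K′⁻¹·Qfᵀ − K⁻¹)·Qᵀ)(x,b′)| ≤ εe^{−δσ(x,b′)}` at a rate `δ ≥ δ₀` (`ρ ≥ 0` from `IsPseudoDist`), the row mass
`Σ_x|Q(b,x)| ≤ q₁` and the gauge compatibility `Q(b,x) ≠ 0 → ρ(b,b′) ≤ σ(x,b′) + R″` ⟹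
`|(𝒮 − 𝒮′)(b,b′)| ≤ 4(Λ+a)²·(q₁εe^{δR″})·Kf(t∕2)²·e^{−(t∕2)ρ(b,b′)}`, `t = rate Kf (Λ+a)⁻¹ c₀ δ₀` — LINEAR in `ε`, instantiable along the tower. -/
theorem abs_effForm_sub_le_of_col (hKf : ∀ r, 0 < r → 0 ≤ Kf r) (hρ : IsPseudoDist ρ) (hS : SumBound ρ Kf) (ha : 0 < a)
    {γ Λ c₀ δ₀ ε δ q₁ R'' : ℝ} (hγ : 0 < γ) (hΛ : 0 ≤ Λ) (hc₀ : 0 ≤ c₀) (hδ₀ : 0 < δ₀) (hε : 0 ≤ ε) (hδ : δ₀ ≤ δ)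
    (hH : Hᵀ = H) (hpsd : ∀ z : ν → ℝ, 0 ≤ z ⬝ᵥ (H *ᵥ z)) (hK : QGQInverse.Coercive (H + Qᵀ * (a • (1 : Matrix c c ℝ)) * Q) γ)
    (hUB : ∀ B : c → ℝ, ∃ u : ν → ℝ, Q *ᵥ u = B ∧ u ⬝ᵥ (H *ᵥ u) ≤ Λ * (B ⬝ᵥ B))
    (hP : ∀ b b', |blockProp (H + Qᵀ * (a • (1 : Matrix c c ℝ)) * Q) Q b b'| ≤ c₀ * Real.exp (-(δ₀ * ρ b b')))
    (hH' : H'ᵀ = H') (hpsd' : ∀ z : ν' → ℝ, 0 ≤ z ⬝ᵥ (H' *ᵥ z))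
    (hK' : QGQInverse.Coercive (H' + (Q * Qf)ᵀ * (a • (1 : Matrix c c ℝ)) * (Q * Qf)) γ)
    (hUB' : ∀ B : c → ℝ, ∃ u : ν' → ℝ, (Q * Qf) *ᵥ u = B ∧ u ⬝ᵥ (H' *ᵥ u) ≤ Λ * (B ⬝ᵥ B))
    (hP' : ∀ b b', |blockProp (H' + (Q * Qf)ᵀ * (a • (1 : Matrix c c ℝ)) * (Q * Qf)) (Q * Qf) b b'| ≤ c₀ * Real.exp (-(δ₀ * ρ b b')))
    (hcol : ∀ x b', |((Qf * (H' + (Q * Qf)ᵀ * (a • (1 : Matrix c c ℝ)) * (Q * Qf))⁻¹ * Qfᵀ - (H + Qᵀ * (a • (1 : Matrix c c ℝ)) * Q)⁻¹) * Qᵀ) x b'| ≤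
      ε * Real.exp (-(δ * σ x b')))
    (hq : ∀ b, ∑ x, |Q b x| ≤ q₁) (hQρσ : ∀ b x b', Q b x ≠ 0 → ρ b b' ≤ σ x b' + R'') (b b' : c) :
    |(effForm H Q - effForm H' (Q * Qf)) b b'| ≤
      4 * (Λ + a) ^ 2 * (q₁ * ε * Real.exp (δ * R'')) * Kf (rate Kf (Λ + a)⁻¹ c₀ δ₀ / 2) ^ 2 *
        Real.exp (-(rate Kf (Λ + a)⁻¹ c₀ δ₀ / 2 * ρ b b')) := by
  have hδ' : 0 ≤ δ := hδ₀.le.trans hδ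
  have hq0 : 0 ≤ q₁ := (Finset.sum_nonneg fun y _ => abs_nonneg (Q b y)).trans (hq b)
  -- the `hdiff` letter of PART 107 at rate `δ₀ ≤ δ`, from the one column letter
  have hdiff : ∀ b b', |(blockProp (H + Qᵀ * (a • (1 : Matrix c c ℝ)) * Q) Q -
      blockProp (H' + (Q * Qf)ᵀ * (a • (1 : Matrix c c ℝ)) * (Q * Qf)) (Q * Qf)) b b'| ≤
      q₁ * ε * Real.exp (δ * R'') * Real.exp (-(δ₀ * ρ b b')) := fun b b' =>
    (abs_blockProp_sub_le_of_col hε hδ' hcol hq hQρσ b b').trans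
      (mul_le_mul_of_nonneg_left (Real.exp_le_exp.mpr (by nlinarith [hρ.nonneg b b'])) (by positivity))
  exact abs_effForm_sub_effForm_le hKf hρ hS ha hγ hΛ hc₀ hδ₀ (by positivity) hH hpsd hK hUB hP hH' hpsd' hK' hUB' hP' hdiff b b'

/-- **`abs_avg_minOp_sub_le_of_col` — Ξ's RATE FROM THE SOFT COLUMNS' ONE-STEP LAW** [our proof; §2 + PART 112 `abs_avg_minOp_sub_le` BY NAME]: under the hypotheses of
`abs_effForm_sub_le_of_col`, the fine-to-unit gauge `σ ≥ 0` compatible with `ρ` (`σ(x,b) ≤ σ(x,b′) + ρ(b′,b)`) and the soft-column decay `|(K⁻¹Qᵀ)(x,b)| ≤ c₁e^{−δ₁σ(x,b)}` at a rate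
`δ₁ ≤ δ`: `|(Qf·ℋ′ − ℋ)(x,b)| ≤ (2(Λ+a)·ε + 4(Λ+a)²Kf(t∕2)²·c₁·q₁εe^{δR″})·Kf(m∕2)·e^{−(m∕2)σ(x,b)}`, `t = rate Kf (Λ+a)⁻¹ c₀ δ₀`, `m = min δ₁ (t∕2)` — LINEAR in `ε`: the
Ξ-block's RATE clause costs the ONE column letter, PART 105's decay letters and the upper bound. -/
theorem abs_avg_minOp_sub_le_of_col (hKf : ∀ r, 0 < r → 0 ≤ Kf r) (hρ : IsPseudoDist ρ) (hS : SumBound ρ Kf) (ha : 0 < a)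
    {γ Λ c₀ δ₀ ε δ q₁ R'' c₁ δ₁ : ℝ} (hγ : 0 < γ) (hΛ : 0 ≤ Λ) (hc₀ : 0 ≤ c₀) (hδ₀ : 0 < δ₀) (hε : 0 ≤ ε) (hδ : δ₀ ≤ δ)
    (hc₁ : 0 ≤ c₁) (hδ₁ : 0 < δ₁) (hδ₁δ : δ₁ ≤ δ)
    (hH : Hᵀ = H) (hpsd : ∀ z : ν → ℝ, 0 ≤ z ⬝ᵥ (H *ᵥ z)) (hK : QGQInverse.Coercive (H + Qᵀ * (a • (1 : Matrix c c ℝ)) * Q) γ)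
    (hUB : ∀ B : c → ℝ, ∃ u : ν → ℝ, Q *ᵥ u = B ∧ u ⬝ᵥ (H *ᵥ u) ≤ Λ * (B ⬝ᵥ B))
    (hP : ∀ b b', |blockProp (H + Qᵀ * (a • (1 : Matrix c c ℝ)) * Q) Q b b'| ≤ c₀ * Real.exp (-(δ₀ * ρ b b')))
    (hH' : H'ᵀ = H') (hpsd' : ∀ z : ν' → ℝ, 0 ≤ z ⬝ᵥ (H' *ᵥ z))
    (hK' : QGQInverse.Coercive (H' + (Q * Qf)ᵀ * (a • (1 : Matrix c c ℝ)) * (Q * Qf)) γ)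
    (hUB' : ∀ B : c → ℝ, ∃ u : ν' → ℝ, (Q * Qf) *ᵥ u = B ∧ u ⬝ᵥ (H' *ᵥ u) ≤ Λ * (B ⬝ᵥ B))
    (hP' : ∀ b b', |blockProp (H' + (Q * Qf)ᵀ * (a • (1 : Matrix c c ℝ)) * (Q * Qf)) (Q * Qf) b b'| ≤ c₀ * Real.exp (-(δ₀ * ρ b b')))
    (hcol : ∀ x b', |((Qf * (H' + (Q * Qf)ᵀ * (a • (1 : Matrix c c ℝ)) * (Q * Qf))⁻¹ * Qfᵀ - (H + Qᵀ * (a • (1 : Matrix c c ℝ)) * Q)⁻¹) * Qᵀ) x b'| ≤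
      ε * Real.exp (-(δ * σ x b')))
    (hq : ∀ b, ∑ x, |Q b x| ≤ q₁) (hQρσ : ∀ b x b', Q b x ≠ 0 → ρ b b' ≤ σ x b' + R'')
    (hσ0 : ∀ x b, 0 ≤ σ x b) (hσρ : ∀ x b b', σ x b ≤ σ x b' + ρ b' b)
    (hT : ∀ x b, |((H + Qᵀ * (a • (1 : Matrix c c ℝ)) * Q)⁻¹ * Qᵀ) x b| ≤ c₁ * Real.exp (-(δ₁ * σ x b))) (x : ν) (b : c) :
    |(Qf * minOp H' (Q * Qf) - minOp H Q) x b| ≤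
      (2 * (Λ + a) * ε + 4 * (Λ + a) ^ 2 * Kf (rate Kf (Λ + a)⁻¹ c₀ δ₀ / 2) ^ 2 * c₁ * (q₁ * ε * Real.exp (δ * R''))) *
        Kf (min δ₁ (rate Kf (Λ + a)⁻¹ c₀ δ₀ / 2) / 2) * Real.exp (-(min δ₁ (rate Kf (Λ + a)⁻¹ c₀ δ₀ / 2) / 2 * σ x b)) := by
  have hδ' : 0 ≤ δ := hδ₀.le.trans hδ
  have hq0 : 0 ≤ q₁ := (Finset.sum_nonneg fun y _ => abs_nonneg (Q b y)).trans (hq b)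
  have hdiff : ∀ b b', |(blockProp (H + Qᵀ * (a • (1 : Matrix c c ℝ)) * Q) Q -
      blockProp (H' + (Q * Qf)ᵀ * (a • (1 : Matrix c c ℝ)) * (Q * Qf)) (Q * Qf)) b b'| ≤
      q₁ * ε * Real.exp (δ * R'') * Real.exp (-(δ₀ * ρ b b')) := fun b b' =>
    (abs_blockProp_sub_le_of_col hε hδ' hcol hq hQρσ b b').trans
      (mul_le_mul_of_nonneg_left (Real.exp_le_exp.mpr (by nlinarith [hρ.nonneg b b'])) (by positivity))
  have hmis : ∀ x b, |(Qf * ((H' + (Q * Qf)ᵀ * (a • (1 : Matrix c c ℝ)) * (Q * Qf))⁻¹ * (Q * Qf)ᵀ) -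
      (H + Qᵀ * (a • (1 : Matrix c c ℝ)) * Q)⁻¹ * Qᵀ) x b| ≤ ε * Real.exp (-(δ₁ * σ x b)) := fun x b =>
    (abs_avg_col_sub_le_of_col hcol x b).trans
      (mul_le_mul_of_nonneg_left (Real.exp_le_exp.mpr (by nlinarith [hσ0 x b])) hε)
  exact abs_avg_minOp_sub_le hKf hρ hS Qf ha hγ hΛ hc₀ hδ₀ hε (by positivity) hc₁ hδ₁ hH hpsd hK hUB hP hH' hpsd' hK' hUB' hP'
    hdiff hσ0 hσρ hT hmis x b

end End

/-! ## §4 (v2) The DECAY letter of the block propagator from the COLUMN decay letter — PART 105 §4 re-based -/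

section Decay

variable {Q : Matrix c ν ℝ} {ρ : c → c → ℝ} {σ : ν → c → ℝ}

omit [Fintype c] [DecidableEq c] in
/-- **`abs_blockProp_le_of_col` — P's DECAY FROM THE SOFT COLUMNS' DECAY** [our proof; §1 with `C := K⁻¹Qᵀ`]: for ANY square `K`, the COLUMN decay letter of PART 105 §3
`|(K⁻¹Qᵀ)(x,b′)| ≤ c₁e^{−δ₁σ(x,b′)}` (`c₁, δ₁ ≥ 0`; the (3.42)-currency statement: one unit leg integrated — k-uniform along the tower, unlike the sup-entry letter of PART 105 §4),
the row mass `Σ_x|Q(b,x)| ≤ q₁` and the gauge compatibility `Q(b,x) ≠ 0 → ρ(b,b′) ≤ σ(x,b′) + R″` ⟹ `|P(b,b′)| = |(QK⁻¹Qᵀ)(b,b′)| ≤ q₁c₁e^{δ₁R″}·e^{−δ₁ρ(b,b′)}` — PART 105 §2's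
letter `hP` with `(c₀, δ₀) = (q₁c₁e^{δ₁R″}, δ₁)`.  So the whole 2 × 2 table (PARTs 105–107, 112–114, 117) runs on TWO COLUMN letters (decay `hT`, rate `hcol`) + UB. -/
theorem abs_blockProp_le_of_col {K : Matrix ν ν ℝ} {c₁ δ₁ q₁ R'' : ℝ} (hc₁ : 0 ≤ c₁) (hδ₁ : 0 ≤ δ₁)
    (hT : ∀ x b', |(K⁻¹ * Qᵀ) x b'| ≤ c₁ * Real.exp (-(δ₁ * σ x b'))) (hq : ∀ b, ∑ x, |Q b x| ≤ q₁)
    (hQρσ : ∀ b x b', Q b x ≠ 0 → ρ b b' ≤ σ x b' + R'') (b b' : c) :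
    |blockProp K Q b b'| ≤ q₁ * c₁ * Real.exp (δ₁ * R'') * Real.exp (-(δ₁ * ρ b b')) := by
  have e : blockProp K Q = Q * (K⁻¹ * Qᵀ) := by rw [blockProp, Matrix.mul_assoc]
  rw [e]
  exact abs_Q_mul_apply_le hc₁ hδ₁ hT hq hQρσ b b'

end Decay

end Summit.QuantumFields.BalabanUV.Beta.GAN24.BlockRatesFromSoftColumn

end
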